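import Literature.AnabelianGeometry.SemiGraphs.PSCTwoComponentAffineShapeEdges
import Literature.AnabelianGeometry.SemiGraphs.PSCSmoothCurveCuspidalCharacterization
import HarnessLib

/-!
# [IUTchI] Rmk. 1.2.3 (iv) (cuspidal) and [CombGC] Thm. 1.6 (i) HOLD at genuine two-component data with cusps

Mochizuki, *A combinatorial version of the Grothendieck conjecture* [CombGC] §1: Prop. 1.2 (i) p. 8,
Thm. 1.6 (i) p. 13 ("`α` is numerically cuspidal if and only if it is group-theoretically cuspidal");
*Inter-universal Teichmüller theory I* [IUTchI] Rmk. 1.2.3 (iv) pp. 41–42 (characterization of the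
cuspidal edge-like subgroups) [cite: MochizukiCombGC2007, Thm 1.6(i) p.13]
[cite: Mochizuki2012, IUTchI Rmk 1.2.3(iv) pp.41-42].  PROOF-ONLY assembly file (abc-iut-f-164 gen 2,
FACT tranche 164; rows F-0459 `PSCDatum.OpenInterDeterminesComponentHolds`, F-1931
`PSCDatum.CuspidalEdgeLikeCharacterizationHolds`, F-0458 `PSCDatum.NumericallyCuspidalIffHolds` — schemata
over the origin parameter `Ω : PSCOrigin` typed by abc-iut-L3-t4).  The data of TWO-COMPONENT AFFINE SHAPE
(two pointed components glued at one node, at least two marked points on each; `Π` a pro-`Σ` completion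
of `Γ_{g,r}`; see `PSCTwoComponentAffineShape.lean`) are the first MULTI-VERTEX data WITH CUSPS at which
these rows are settled in the kernel (abc-iut-L3-t4's `PSC-ORIGIN-ROWS-STATUS.md`: "What is NOT known in
kernel: any row at genuine MULTI-VERTEX data").

## What is proved

* **F-1931 at cuspidally standard origins, vertex-free** (`cuspidalEdgeLikeCharacterizationHolds_of_cuspidallyStandard`):
  [IUTchI] Rmk. 1.2.3 (iv) (cuspidal part, BOTH halves) HOLDS at every origin all of whose data are
  *cuspidally standard* — `Π` profinite, a pro-`Σ'` completion `ι : Γ_{g,r} → Π` of a hyperbolic punctured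
  surface group, cusp groups = the closed cusp inertia groups `closure ι⟨c_j⟩` (all `r` of them) —
  WHATEVER THE VERTICES AND NODES: abc-iut-L3-t4's forward half
  (`cuspidalEdgeLikeCharacterization_mp_of_smoothCurve`, malnormality of cusp inertia) and abc-iut-f-164's
  converse (`cuspidalEdgeLikeCharacterization_of_mp`, compactness + Serre) never use the one-vertex
  hypothesis.  Geometrically every pointed stable curve of type `(g, r)` is expected to yield such a datum
  (its PSC-fundamental group is the pro-`Σ` completion of `π₁` of the smooth surface `S_{g,r}` into which it
  deforms, marked points ↦ boundary loops); that identification is not constructed in the tree and is a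
  hypothesis on the shape of the data here.
* **Data of two-component affine shape exist** over a pro-`Σ` completion of every `Γ_{g,r}`, for every set
  of primes `Σ` and all splittings `(g₀, s)` (`exists_twoComponentAffineDatum`; the completion is
  `IsProSigmaCompletion.exists_isProSigmaCompletion`): underlying semi-graph `V = Bool` (`false` = `C₀`,
  `true` = `C₁`), one node joining them, cusps `Fin r` with `c_j` on `C₁` iff `j < s`.
* **F-0459 and F-0458 at every origin of two-component affine data** (`Σ = {l}` for F-0458:
  `openInterDeterminesComponentHolds_of_twoComponentAffine`, `numericallyCuspidalIffHolds_of_twoComponentAffine`),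
  the latter by abc-iut-f-164's shape-free reduction `numericallyCuspidalIffHolds_of_characterization`
  ("F-0458 ⇐ F-0459 + F-1931 at profinite pro-`l` origins", after abc-iut-w4-d052's datum-level theorem).
* **`exists_twoComponentAffineOrigin_thm16i_holds`**: for a prime `l`, the origin of the two-component
  affine data with `Σ = {l}` satisfies F-0459 ∧ F-1931 ∧ F-0458 and is INHABITED by the pro-`l` datum of
  `Γ_{0,4}` split as TWO TRIPODS glued at a node (the stable curve at a boundary point of `M̄_{0,4}`: two
  `P¹`'s, each with two marked points and the node) and by the STURDY datum over `Γ_{4,4}` (`g₀ = 2`,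
  so that the unramified conjunct of Prop. 1.2 (i) is not vacuous there).

Honest scope: instance forms at data of the shape of genuine two-component curves (each component with
at least two marked points) — consistency evidence for the typed rows, not the printed theorems for all
pointed stable curves.  Nothing here takes a side on [IUTchIII] Cor. 3.12.
-/

noncomputable section

namespace Literature.AnabelianGeometry.SemiGraphs

open scoped Pointwise
open Literature.GroupTheory.CombinatorialGroupTheory
open SemiGraphOfAnabelioids (IsProSigmaCompletion)
open Multiplicative

universe u

namespace PSCDatum

/-! ### F-1931 at cuspidally standard origins — vertex-free -/

section CuspidallyStandard

variable (Ω : PSCOrigin.{u})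

/-- **F-1931 ([IUTchI] Rmk. 1.2.3 (iv), cuspidal part, both halves) HOLDS at every origin of CUSPIDALLY
STANDARD data, whatever their vertices and nodes**: data over a profinite `Π` presented as a pro-`Σ'`
completion `ι : Γ_{g,r} → Π` of a hyperbolic punctured surface group whose cusp groups are the closed cusp
inertia groups `closure ι⟨c_j⟩`.  (abc-iut-L3-t4's forward half and abc-iut-f-164's converse, composed in
`cuspidalEdgeLikeCharacterization_of_smoothCurve`, only ever use `ι` and the cusp groups.)
[cite: Mochizuki2012, IUTchI Rmk 1.2.3(iv) pp.41-42] -/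
theorem cuspidalEdgeLikeCharacterizationHolds_of_cuspidallyStandard
    (hΩ : ∀ ⦃Q : Type u⦄ [Group Q] [TopologicalSpace Q] [IsTopologicalGroup Q] (G : PSCDatum Q),
      Ω.IsOfPSCType G → CompactSpace Q ∧ T2Space Q ∧ TotallyDisconnectedSpace Q ∧
        ∃ (S : Set ℕ) (g r : ℕ) (ι : PuncturedSurfaceGroup g r →* Q) (e : G.graph.C ≃ Fin r),
          S.Nonempty ∧ (∀ p ∈ S, p.Prime) ∧ PuncturedSurfaceGroup.IsHyperbolicType g r ∧
          IsProSigmaCompletion S ι ∧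
          ∀ c, G.cuspGp c =
            ((PuncturedSurfaceGroup.cuspInertia (g := g) (e c)).map ι).topologicalClosure) :
    CuspidalEdgeLikeCharacterizationHolds Ω := by
  intro Q _ _ _ G hG
  obtain ⟨hc, ht, hd, S, g, r, ι, e, hne, hprime, hh, hι, hC⟩ := hΩ G hG
  exact G.cuspidalEdgeLikeCharacterization_of_smoothCurve hne hprime hh ι hι e hC

end CuspidallyStandard

/-! ### Data of two-component affine shape exist -/

/-- **Data of two-component affine shape exist** over a pro-`Σ` completion `ι : Γ_{g,r} → Π` (for every
set `Σ` and every splitting `g₀`, `s`): underlying semi-graph with vertices `Bool` (`false` = `C₀`,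
`true` = `C₁`), one node joining them, cusps `Fin r` attached to `C₁` iff `j < s`; `Π_{c_j}` = closure
`ι⟨c_j⟩`, `Π_{v₀}` / `Π_{v₁}` the closures of the two subsurface groups, `Π_ν` = closure `ι⟨ε⟩`, genera
`g₀`, `g − g₀`.  The branch inclusions of Def. 1.1 hold with trivial conjugators (`ε` lies in both
subsurface groups: it is a word in the generators of `C₀`, and a listed generator of `C₁`'s group).
[cite: MochizukiCombGC2007, Def 1.1 pp.6-7] -/
theorem exists_twoComponentAffineDatum (Sigma : Set ℕ) (hne : Sigma.Nonempty)
    (hprime : ∀ p ∈ Sigma, p.Prime) (g r g₀ s : ℕ) :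
    ∃ (Q : ProfiniteGrp.{0}) (ι : PuncturedSurfaceGroup g r →* Q) (G : PSCDatum Q)
      (e : G.graph.C ≃ Fin r) (v₀ v₁ : G.graph.V) (n₀ : G.graph.N) (ε : PuncturedSurfaceGroup g r),
      IsProSigmaCompletion Sigma ι ∧ G.Sigma = Sigma ∧ G.graph.i = 2 ∧ G.graph.n = 1 ∧ G.graph.r = r ∧
      (∀ c, G.cuspGp c =
        ((PuncturedSurfaceGroup.cuspInertia (g := g) (e c)).map ι).topologicalClosure) ∧
      (∀ w, w = v₀ ∨ w = v₁) ∧ (∀ n, n = n₀) ∧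
      ε = ((List.finRange r).map fun j : Fin r =>
            if s ≤ (j : ℕ) then PuncturedSurfaceGroup.c (g := g) j else 1).prod *
          ((List.finRange g).map fun i : Fin g => if (i : ℕ) < g₀ then
            PuncturedSurfaceGroup.a (r := r) i * PuncturedSurfaceGroup.b i *
              (PuncturedSurfaceGroup.a i)⁻¹ * (PuncturedSurfaceGroup.b i)⁻¹ else 1).prod ∧
      G.vertGp v₀ = ((Subgroup.closure {x : PuncturedSurfaceGroup g r |
            (∃ i : Fin g, (i : ℕ) < g₀ ∧ (x = PuncturedSurfaceGroup.a i ∨ x = PuncturedSurfaceGroup.b i)) ∨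
            ∃ j : Fin r, s ≤ (j : ℕ) ∧ x = PuncturedSurfaceGroup.c j}).map ι).topologicalClosure ∧
      G.vertGp v₁ = ((Subgroup.closure {x : PuncturedSurfaceGroup g r |
            (∃ i : Fin g, g₀ ≤ (i : ℕ) ∧ (x = PuncturedSurfaceGroup.a i ∨ x = PuncturedSurfaceGroup.b i)) ∨
            (∃ j : Fin r, (j : ℕ) < s ∧ x = PuncturedSurfaceGroup.c j) ∨ x = ε}).map ι).topologicalClosure ∧
      G.nodeGp n₀ = ((Subgroup.zpowers ε).map ι).topologicalClosure ∧
      G.genus v₀ = g₀ ∧ G.genus v₁ = g - g₀ ∧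
      (∀ n, G.graph.nodeEnds n = s(v₀, v₁)) ∧ (∀ c, G.graph.cuspEnd c = v₁ ↔ ((e c : Fin r) : ℕ) < s) := by
  classical
  obtain ⟨Q, ι, hι⟩ :=
    IsProSigmaCompletion.exists_isProSigmaCompletion (PuncturedSurfaceGroup g r) Sigma
  let ε : PuncturedSurfaceGroup g r := ((List.finRange r).map fun j : Fin r =>
            if s ≤ (j : ℕ) then PuncturedSurfaceGroup.c (g := g) j else 1).prod *
          ((List.finRange g).map fun i : Fin g => if (i : ℕ) < g₀ then
            PuncturedSurfaceGroup.a (r := r) i * PuncturedSurfaceGroup.b i *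
              (PuncturedSurfaceGroup.a i)⁻¹ * (PuncturedSurfaceGroup.b i)⁻¹ else 1).prod
  let S₀ : Set (PuncturedSurfaceGroup g r) := {x |
    (∃ i : Fin g, (i : ℕ) < g₀ ∧ (x = PuncturedSurfaceGroup.a i ∨ x = PuncturedSurfaceGroup.b i)) ∨
    ∃ j : Fin r, s ≤ (j : ℕ) ∧ x = PuncturedSurfaceGroup.c j}
  let S₁ : Set (PuncturedSurfaceGroup g r) := {x |
    (∃ i : Fin g, g₀ ≤ (i : ℕ) ∧ (x = PuncturedSurfaceGroup.a i ∨ x = PuncturedSurfaceGroup.b i)) ∨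
    (∃ j : Fin r, (j : ℕ) < s ∧ x = PuncturedSurfaceGroup.c j) ∨ x = ε}
  let A₀ : Subgroup Q := ((Subgroup.closure S₀).map ι).topologicalClosure
  let A₁ : Subgroup Q := ((Subgroup.closure S₁).map ι).topologicalClosure
  -- the node loop lies in both subsurface groups
  have hε₀ : ε ∈ Subgroup.closure S₀ := by
    refine Subgroup.mul_mem _ (Subgroup.list_prod_mem _ fun x hx => ?_)
      (Subgroup.list_prod_mem _ fun x hx => ?_)
    · obtain ⟨j, -, rfl⟩ := List.mem_map.mp hx
      split_ifs with h
      · exact Subgroup.subset_closure (Or.inr ⟨j, h, rfl⟩)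
      · exact Subgroup.one_mem _
    · obtain ⟨i, -, rfl⟩ := List.mem_map.mp hx
      split_ifs with h
      · have ha : PuncturedSurfaceGroup.a (r := r) i ∈ Subgroup.closure S₀ :=
          Subgroup.subset_closure (Or.inl ⟨i, h, Or.inl rfl⟩)
        have hb : PuncturedSurfaceGroup.b (r := r) i ∈ Subgroup.closure S₀ :=
          Subgroup.subset_closure (Or.inl ⟨i, h, Or.inr rfl⟩)
        exact Subgroup.mul_mem _ (Subgroup.mul_mem _ (Subgroup.mul_mem _ ha hb)
          (Subgroup.inv_mem _ ha)) (Subgroup.inv_mem _ hb)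
      · exact Subgroup.one_mem _
  have hε₁ : ε ∈ Subgroup.closure S₁ := Subgroup.subset_closure (Or.inr (Or.inr rfl))
  have hN₀ : ((Subgroup.zpowers ε).map ι).topologicalClosure ≤ A₀ :=
    Subgroup.topologicalClosure_mono (Subgroup.map_mono ((Subgroup.zpowers_le).mpr hε₀))
  have hN₁ : ((Subgroup.zpowers ε).map ι).topologicalClosure ≤ A₁ :=
    Subgroup.topologicalClosure_mono (Subgroup.map_mono ((Subgroup.zpowers_le).mpr hε₁))
  let T : PSCDatum Q :=
    { Sigma := Sigma
      sigma_prime := hprime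
      sigma_nonempty := hne
      graph :=
        { V := Bool, N := Unit, C := Fin r, nodeEnds := fun _ => s(false, true)
          cuspEnd := fun j => decide ((j : ℕ) < s) }
      vertGp := fun v => bif v then A₁ else A₀
      nodeGp := fun _ => ((Subgroup.zpowers ε).map ι).topologicalClosure
      cuspGp := fun j => ((PuncturedSurfaceGroup.cuspInertia (g := g) j).map ι).topologicalClosure
      genus := fun v => bif v then g - g₀ else g₀
      isClosed_vertGp := fun v => by cases v <;> exact Subgroup.isClosed_topologicalClosure _
      isClosed_nodeGp := fun _ => Subgroup.isClosed_topologicalClosure _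
      isClosed_cuspGp := fun _ => Subgroup.isClosed_topologicalClosure _
      nodeGp_le := fun _ => ⟨false, true, rfl, ⟨1, by rw [one_smul]; exact hN₀⟩,
        ⟨1, by rw [one_smul]; exact hN₁⟩⟩
      cuspGp_le := fun j => ⟨1, by
        rw [one_smul]
        by_cases h : (j : ℕ) < s
        · simp only [h, decide_true, cond_true]
          exact Subgroup.topologicalClosure_mono (Subgroup.map_mono
            ((Subgroup.zpowers_le).mpr (Subgroup.subset_closure (Or.inr (Or.inl ⟨j, h, rfl⟩)))))
        · simp only [h, decide_false, cond_false]
          exact Subgroup.topologicalClosure_mono (Subgroup.map_mono ((Subgroup.zpowers_le).mpr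
            (Subgroup.subset_closure (Or.inr ⟨j, not_lt.mp h, rfl⟩))))⟩
      proSigma := isProSigma_of_isProSigmaCompletion hι }
  refine ⟨Q, ι, T, Equiv.refl _, false, true, (), ε, hι, rfl, rfl, rfl, Fintype.card_fin r,
    fun _ => rfl, fun w => ?_, fun n => ?_, rfl, rfl, rfl, rfl, rfl, rfl, fun _ => rfl, fun c => ?_⟩
  · cases w
    · exact Or.inl rfl
    · exact Or.inr rfl
  · cases n; rfl
  · change decide (((c : Fin r) : ℕ) < s) = true ↔ _
    rw [decide_eq_true_iff]
    rfl

/-! ### F-0459 and F-0458 at origins of two-component affine data -/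

section Origin

variable (Ω : PSCOrigin.{u}) (l : ℕ)

/-- **F-0459 / [CombGC] Prop. 1.2 (i) (all three cases) at every origin whose data are of two-component
affine shape** (profinite `Π`; at least two marked points on each component).
[cite: MochizukiCombGC2007, Prop 1.2(i) p.8] -/
theorem openInterDeterminesComponentHolds_of_twoComponentAffine
    (hΩ : ∀ ⦃Q : Type u⦄ [Group Q] [TopologicalSpace Q] [IsTopologicalGroup Q] (G : PSCDatum Q),
      Ω.IsOfPSCType G → CompactSpace Q ∧ T2Space Q ∧ TotallyDisconnectedSpace Q ∧
        ∃ (S : Set ℕ) (g r g₀ s : ℕ) (ι : PuncturedSurfaceGroup g r →* Q) (e : G.graph.C ≃ Fin r)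
          (v₀ v₁ : G.graph.V) (n₀ : G.graph.N) (ε : PuncturedSurfaceGroup g r),
          S.Nonempty ∧ (∀ p ∈ S, p.Prime) ∧ IsProSigmaCompletion S ι ∧ g₀ ≤ g ∧ 2 ≤ s ∧ s + 2 ≤ r ∧
          (∀ c, G.cuspGp c =
            ((PuncturedSurfaceGroup.cuspInertia (g := g) (e c)).map ι).topologicalClosure) ∧
          (∀ w, w = v₀ ∨ w = v₁) ∧ (∀ n, n = n₀) ∧
          ε = ((List.finRange r).map fun j : Fin r =>
            if s ≤ (j : ℕ) then PuncturedSurfaceGroup.c (g := g) j else 1).prod *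
          ((List.finRange g).map fun i : Fin g => if (i : ℕ) < g₀ then
            PuncturedSurfaceGroup.a (r := r) i * PuncturedSurfaceGroup.b i *
              (PuncturedSurfaceGroup.a i)⁻¹ * (PuncturedSurfaceGroup.b i)⁻¹ else 1).prod ∧
          G.vertGp v₀ = ((Subgroup.closure {x : PuncturedSurfaceGroup g r |
            (∃ i : Fin g, (i : ℕ) < g₀ ∧ (x = PuncturedSurfaceGroup.a i ∨ x = PuncturedSurfaceGroup.b i)) ∨
            ∃ j : Fin r, s ≤ (j : ℕ) ∧ x = PuncturedSurfaceGroup.c j}).map ι).topologicalClosure ∧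
          G.vertGp v₁ = ((Subgroup.closure {x : PuncturedSurfaceGroup g r |
            (∃ i : Fin g, g₀ ≤ (i : ℕ) ∧ (x = PuncturedSurfaceGroup.a i ∨ x = PuncturedSurfaceGroup.b i)) ∨
            (∃ j : Fin r, (j : ℕ) < s ∧ x = PuncturedSurfaceGroup.c j) ∨ x = ε}).map ι).topologicalClosure ∧
          G.nodeGp n₀ = ((Subgroup.zpowers ε).map ι).topologicalClosure ∧
          G.genus v₀ = g₀ ∧ G.genus v₁ = g - g₀) :
    OpenInterDeterminesComponentHolds Ω := by
  intro Q _ _ _ G hG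
  obtain ⟨hc, -, hd, S, g, r, g₀, s, ι, e, v₀, v₁, n₀, ε, hne, hprime, hι, hg₀, hs, hsr, hC, hV, hN, hε,
    hV₀, hV₁, hE, hgen₀, hgen₁⟩ := hΩ G hG
  exact G.openInterDeterminesComponent_of_twoComponentAffine hne hprime ι hι hg₀ hs hsr e hC v₀ v₁ hV
    ε hε hV₀ hV₁ n₀ hN hE hgen₀ hgen₁

/-- **F-0458 / [CombGC] Thm. 1.6 (i) as printed at every origin whose data are of two-component affine
shape with `Σ = {l}`**: "`α` is numerically cuspidal iff it is group-theoretically cuspidal" for all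
`G`, `H` of `Ω`-type and every `α : Π_G ≅ Π_H` — unconditionally, by composition: Prop. 1.2 (i) holds there
(`openInterDeterminesComponentHolds_of_twoComponentAffine`), [IUTchI] Rmk. 1.2.3 (iv) (cuspidal) holds
there (`cuspidalEdgeLikeCharacterizationHolds_of_cuspidallyStandard`; `(g, r)` is hyperbolic as `r ≥ 4`),
and F-0458 ⇐ F-0459 + F-1931 at profinite pro-`l` origins (abc-iut-f-164's
`numericallyCuspidalIffHolds_of_characterization`). [cite: MochizukiCombGC2007, Thm 1.6(i) p.13] -/
theorem numericallyCuspidalIffHolds_of_twoComponentAffine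
    (hΩ : ∀ ⦃Q : Type u⦄ [Group Q] [TopologicalSpace Q] [IsTopologicalGroup Q] (G : PSCDatum Q),
      Ω.IsOfPSCType G → CompactSpace Q ∧ T2Space Q ∧ TotallyDisconnectedSpace Q ∧
        ∃ (S : Set ℕ) (g r g₀ s : ℕ) (ι : PuncturedSurfaceGroup g r →* Q) (e : G.graph.C ≃ Fin r)
          (v₀ v₁ : G.graph.V) (n₀ : G.graph.N) (ε : PuncturedSurfaceGroup g r),
          S.Nonempty ∧ (∀ p ∈ S, p.Prime) ∧ IsProSigmaCompletion S ι ∧ g₀ ≤ g ∧ 2 ≤ s ∧ s + 2 ≤ r ∧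
          (∀ c, G.cuspGp c =
            ((PuncturedSurfaceGroup.cuspInertia (g := g) (e c)).map ι).topologicalClosure) ∧
          (∀ w, w = v₀ ∨ w = v₁) ∧ (∀ n, n = n₀) ∧
          ε = ((List.finRange r).map fun j : Fin r =>
            if s ≤ (j : ℕ) then PuncturedSurfaceGroup.c (g := g) j else 1).prod *
          ((List.finRange g).map fun i : Fin g => if (i : ℕ) < g₀ then
            PuncturedSurfaceGroup.a (r := r) i * PuncturedSurfaceGroup.b i *
              (PuncturedSurfaceGroup.a i)⁻¹ * (PuncturedSurfaceGroup.b i)⁻¹ else 1).prod ∧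
          G.vertGp v₀ = ((Subgroup.closure {x : PuncturedSurfaceGroup g r |
            (∃ i : Fin g, (i : ℕ) < g₀ ∧ (x = PuncturedSurfaceGroup.a i ∨ x = PuncturedSurfaceGroup.b i)) ∨
            ∃ j : Fin r, s ≤ (j : ℕ) ∧ x = PuncturedSurfaceGroup.c j}).map ι).topologicalClosure ∧
          G.vertGp v₁ = ((Subgroup.closure {x : PuncturedSurfaceGroup g r |
            (∃ i : Fin g, g₀ ≤ (i : ℕ) ∧ (x = PuncturedSurfaceGroup.a i ∨ x = PuncturedSurfaceGroup.b i)) ∨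
            (∃ j : Fin r, (j : ℕ) < s ∧ x = PuncturedSurfaceGroup.c j) ∨ x = ε}).map ι).topologicalClosure ∧
          G.nodeGp n₀ = ((Subgroup.zpowers ε).map ι).topologicalClosure ∧
          G.genus v₀ = g₀ ∧ G.genus v₁ = g - g₀)
    (hSig : ∀ ⦃Q : Type u⦄ [Group Q] [TopologicalSpace Q] [IsTopologicalGroup Q] (G : PSCDatum Q),
      Ω.IsOfPSCType G → G.Sigma = {l}) :
    NumericallyCuspidalIffHolds Ω :=
  numericallyCuspidalIffHolds_of_characterization Ω l
    (fun _ _ _ _ G hG => ⟨(hΩ G hG).1, (hΩ G hG).2.2.1⟩) hSig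
    (openInterDeterminesComponentHolds_of_twoComponentAffine Ω hΩ)
    (cuspidalEdgeLikeCharacterizationHolds_of_cuspidallyStandard Ω fun Q _ _ _ G hG => by
      obtain ⟨hc, ht, hd, S, g, r, g₀, s, ι, e, v₀, v₁, n₀, ε, hne, hprime, hι, hg₀, hs, hsr, hC, -⟩ :=
        hΩ G hG
      exact ⟨hc, ht, hd, S, g, r, ι, e, hne, hprime,
        by unfold PuncturedSurfaceGroup.IsHyperbolicType; omega, hι, hC⟩)

end Origin

/-! ### The origin with `Σ = {l}`: inhabited by two tripods glued at a node, and by sturdy data -/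

/-- **At the origin of two-component affine data with `Σ = {l}` — inhabited by the pro-`l` datum "two
tripods glued at a node" (`Γ_{0,4}`, `g₀ = 0`, `s = 2`) and by the STURDY datum over `Γ_{4,4}` (`g₀ = 2`,
`s = 2`) — F-0459 ([CombGC] Prop. 1.2 (i)), F-1931 ([IUTchI] Rmk. 1.2.3 (iv), cuspidal) and F-0458
([CombGC] Thm. 1.6 (i)) all HOLD.**  The first multi-vertex data with cusps at which these rows are
settled in the kernel; instance forms at data of the shape of genuine two-component curves, not the
printed theorems for all pointed stable curves.
[cite: MochizukiCombGC2007, Thm 1.6(i) p.13] [cite: MochizukiCombGC2007, Prop 1.2(i) p.8]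
[cite: Mochizuki2012, IUTchI Rmk 1.2.3(iv) pp.41-42] -/
theorem exists_twoComponentAffineOrigin_thm16i_holds (l : ℕ) (hl : l.Prime) :
    ∃ Ω : PSCOrigin.{0},
      (∃ (Q : ProfiniteGrp.{0}) (ι : PuncturedSurfaceGroup 0 4 →* Q) (G : PSCDatum Q),
        IsProSigmaCompletion {l} ι ∧ Ω.IsOfPSCType G ∧ G.Sigma = {l} ∧ G.graph.i = 2 ∧ G.graph.n = 1 ∧
          G.graph.r = 4 ∧ (∀ v, G.genus v = 0) ∧
          ∀ c, ∃ j : Fin 4, G.cuspGp c =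
            ((PuncturedSurfaceGroup.cuspInertia (g := 0) j).map ι).topologicalClosure) ∧
      (∃ (Q : ProfiniteGrp.{0}) (ι : PuncturedSurfaceGroup 4 4 →* Q) (G : PSCDatum Q),
        IsProSigmaCompletion {l} ι ∧ Ω.IsOfPSCType G ∧ G.IsSturdy ∧ G.graph.i = 2 ∧ G.graph.n = 1 ∧
          G.graph.r = 4) ∧
      OpenInterDeterminesComponentHolds Ω ∧ CuspidalEdgeLikeCharacterizationHolds Ω ∧
      NumericallyCuspidalIffHolds Ω := by
  classical
  let Ω : PSCOrigin.{0} :=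
    ⟨fun {Q} _ _ G => ∃ (_ : IsTopologicalGroup Q), G.Sigma = {l} ∧
      (CompactSpace Q ∧ T2Space Q ∧ TotallyDisconnectedSpace Q ∧
        ∃ (S : Set ℕ) (g r g₀ s : ℕ) (ι : PuncturedSurfaceGroup g r →* Q) (e : G.graph.C ≃ Fin r)
          (v₀ v₁ : G.graph.V) (n₀ : G.graph.N) (ε : PuncturedSurfaceGroup g r),
          S.Nonempty ∧ (∀ p ∈ S, p.Prime) ∧ IsProSigmaCompletion S ι ∧ g₀ ≤ g ∧ 2 ≤ s ∧ s + 2 ≤ r ∧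
          (∀ c, G.cuspGp c =
            ((PuncturedSurfaceGroup.cuspInertia (g := g) (e c)).map ι).topologicalClosure) ∧
          (∀ w, w = v₀ ∨ w = v₁) ∧ (∀ n, n = n₀) ∧
          ε = ((List.finRange r).map fun j : Fin r =>
            if s ≤ (j : ℕ) then PuncturedSurfaceGroup.c (g := g) j else 1).prod *
          ((List.finRange g).map fun i : Fin g => if (i : ℕ) < g₀ then
            PuncturedSurfaceGroup.a (r := r) i * PuncturedSurfaceGroup.b i *
              (PuncturedSurfaceGroup.a i)⁻¹ * (PuncturedSurfaceGroup.b i)⁻¹ else 1).prod ∧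
          G.vertGp v₀ = ((Subgroup.closure {x : PuncturedSurfaceGroup g r |
            (∃ i : Fin g, (i : ℕ) < g₀ ∧ (x = PuncturedSurfaceGroup.a i ∨ x = PuncturedSurfaceGroup.b i)) ∨
            ∃ j : Fin r, s ≤ (j : ℕ) ∧ x = PuncturedSurfaceGroup.c j}).map ι).topologicalClosure ∧
          G.vertGp v₁ = ((Subgroup.closure {x : PuncturedSurfaceGroup g r |
            (∃ i : Fin g, g₀ ≤ (i : ℕ) ∧ (x = PuncturedSurfaceGroup.a i ∨ x = PuncturedSurfaceGroup.b i)) ∨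
            (∃ j : Fin r, (j : ℕ) < s ∧ x = PuncturedSurfaceGroup.c j) ∨ x = ε}).map ι).topologicalClosure ∧
          G.nodeGp n₀ = ((Subgroup.zpowers ε).map ι).topologicalClosure ∧
          G.genus v₀ = g₀ ∧ G.genus v₁ = g - g₀)⟩
  have hΩ : ∀ ⦃Q : Type⦄ [Group Q] [TopologicalSpace Q] [IsTopologicalGroup Q] (G : PSCDatum Q),
      Ω.IsOfPSCType G → CompactSpace Q ∧ T2Space Q ∧ TotallyDisconnectedSpace Q ∧
        ∃ (S : Set ℕ) (g r g₀ s : ℕ) (ι : PuncturedSurfaceGroup g r →* Q) (e : G.graph.C ≃ Fin r)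
          (v₀ v₁ : G.graph.V) (n₀ : G.graph.N) (ε : PuncturedSurfaceGroup g r),
          S.Nonempty ∧ (∀ p ∈ S, p.Prime) ∧ IsProSigmaCompletion S ι ∧ g₀ ≤ g ∧ 2 ≤ s ∧ s + 2 ≤ r ∧
          (∀ c, G.cuspGp c =
            ((PuncturedSurfaceGroup.cuspInertia (g := g) (e c)).map ι).topologicalClosure) ∧
          (∀ w, w = v₀ ∨ w = v₁) ∧ (∀ n, n = n₀) ∧
          ε = ((List.finRange r).map fun j : Fin r =>
            if s ≤ (j : ℕ) then PuncturedSurfaceGroup.c (g := g) j else 1).prod *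
          ((List.finRange g).map fun i : Fin g => if (i : ℕ) < g₀ then
            PuncturedSurfaceGroup.a (r := r) i * PuncturedSurfaceGroup.b i *
              (PuncturedSurfaceGroup.a i)⁻¹ * (PuncturedSurfaceGroup.b i)⁻¹ else 1).prod ∧
          G.vertGp v₀ = ((Subgroup.closure {x : PuncturedSurfaceGroup g r |
            (∃ i : Fin g, (i : ℕ) < g₀ ∧ (x = PuncturedSurfaceGroup.a i ∨ x = PuncturedSurfaceGroup.b i)) ∨
            ∃ j : Fin r, s ≤ (j : ℕ) ∧ x = PuncturedSurfaceGroup.c j}).map ι).topologicalClosure ∧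
          G.vertGp v₁ = ((Subgroup.closure {x : PuncturedSurfaceGroup g r |
            (∃ i : Fin g, g₀ ≤ (i : ℕ) ∧ (x = PuncturedSurfaceGroup.a i ∨ x = PuncturedSurfaceGroup.b i)) ∨
            (∃ j : Fin r, (j : ℕ) < s ∧ x = PuncturedSurfaceGroup.c j) ∨ x = ε}).map ι).topologicalClosure ∧
          G.nodeGp n₀ = ((Subgroup.zpowers ε).map ι).topologicalClosure ∧
          G.genus v₀ = g₀ ∧ G.genus v₁ = g - g₀ :=
    fun Q _ _ _ G hG => hG.2.2
  have hSig : ∀ ⦃Q : Type⦄ [Group Q] [TopologicalSpace Q] [IsTopologicalGroup Q] (G : PSCDatum Q),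
      Ω.IsOfPSCType G → G.Sigma = {l} := fun Q _ _ _ G hG => hG.2.1
  have hl' : ∀ p ∈ ({l} : Set ℕ), p.Prime := fun p hp => by
    rw [Set.mem_singleton_iff.mp hp]; exact hl
  -- membership of the generic datum
  have hmem : ∀ (g r g₀ s : ℕ), g₀ ≤ g → 2 ≤ s → s + 2 ≤ r →
      ∃ (Q : ProfiniteGrp.{0}) (ι : PuncturedSurfaceGroup g r →* Q) (G : PSCDatum Q)
        (e : G.graph.C ≃ Fin r),
        IsProSigmaCompletion {l} ι ∧ Ω.IsOfPSCType G ∧ G.Sigma = {l} ∧ G.graph.i = 2 ∧ G.graph.n = 1 ∧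
          G.graph.r = r ∧ (∃ v₀ v₁ : G.graph.V, (∀ w, w = v₀ ∨ w = v₁) ∧ G.genus v₀ = g₀ ∧
            G.genus v₁ = g - g₀) ∧
          ∀ c, G.cuspGp c =
            ((PuncturedSurfaceGroup.cuspInertia (g := g) (e c)).map ι).topologicalClosure := by
    intro g r g₀ s hg₀ hs hsr
    obtain ⟨Q, ι, G, e, v₀, v₁, n₀, ε, hι, hS, hi, hn, hr, hC, hV, hN, hε, hV₀, hV₁, hE, hgen₀, hgen₁,
      -, -⟩ := exists_twoComponentAffineDatum {l} ⟨l, rfl⟩ hl' g r g₀ s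
    exact ⟨Q, ι, G, e, hι, ⟨inferInstance, hS, inferInstance, inferInstance, inferInstance, {l}, g, r,
      g₀, s, ι, e, v₀, v₁, n₀, ε, ⟨l, rfl⟩, hl', hι, hg₀, hs, hsr, hC, hV, hN, hε, hV₀, hV₁, hE, hgen₀,
      hgen₁⟩, hS, hi, hn, hr, ⟨v₀, v₁, hV, hgen₀, hgen₁⟩, hC⟩
  refine ⟨Ω, ?_, ?_, openInterDeterminesComponentHolds_of_twoComponentAffine Ω hΩ,
    cuspidalEdgeLikeCharacterizationHolds_of_cuspidallyStandard Ω (fun Q _ _ _ G hG => ?_),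
    numericallyCuspidalIffHolds_of_twoComponentAffine Ω l hΩ hSig⟩
  · obtain ⟨Q, ι, G, e, hι, hG, hS, hi, hn, hr, ⟨v₀, v₁, hV, hg₀, hg₁⟩, hC⟩ :=
      hmem 0 4 0 2 le_rfl le_rfl le_rfl
    refine ⟨Q, ι, G, hι, hG, hS, hi, hn, hr, fun v => ?_, fun c => ⟨e c, hC c⟩⟩
    rcases hV v with rfl | rfl
    · exact hg₀
    · exact hg₁
  · obtain ⟨Q, ι, G, e, hι, hG, -, hi, hn, hr, ⟨v₀, v₁, hV, hg₀, hg₁⟩, -⟩ :=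
      hmem 4 4 2 2 (by norm_num) le_rfl le_rfl
    refine ⟨Q, ι, G, hι, hG, fun v => ?_, hi, hn, hr⟩
    rcases hV v with rfl | rfl
    · rw [hg₀]
    · rw [hg₁]
  · obtain ⟨hc, ht, hd, S, g, r, g₀, s, ι, e, v₀, v₁, n₀, ε, hne, hprime, hι, hg₀, hs, hsr, hC, -⟩ :=
      hΩ G hG
    exact ⟨hc, ht, hd, S, g, r, ι, e, hne, hprime,
      by unfold PuncturedSurfaceGroup.IsHyperbolicType; omega, hι, hC⟩

end PSCDatum

end Literature.AnabelianGeometry.SemiGraphs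

end
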